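import Mathlib.Combinatorics.SimpleGraph.Connectivity.Connected
import Literature.Topology.FourManifolds.KhComplex
import HarnessLib

/-!
# The Khovanov differential preserves the quantum degree:
discharge of `qDegree_eq_of_incidence_ne_zero`

Sibling proof file of `KhComplex.lean` (D-0014). It discharges

* `Literature.Topology.FourManifolds.GaussDiagram.qDegree_eq_of_incidence_ne_zero_holds :
  qDegree_eq_of_incidence_ne_zero` — **at `h = t = 0` a nonzero integral incidence number
  `⟨d s, s'⟩` between enhanced states of a Gauss diagram forces `qDegree s' = qDegree s`.**

Source. M. Khovanov, *A categorification of the Jones polynomial*, Duke Math. J. 101 (2000)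
359–426 (arXiv:math/9908171), §4.2, just before Prop. 8: the structure map `ξ_a^{V_D}(ℒ)` of
the cube `V_D` is induced by the saddle cobordism `S`, `F(S)` has degree `-1 = χ(S)`, and with
the shifts `V_D(ℒ) = F(D(ℒ)){-|ℒ|}`, `V_D(ℒa) = F(D(ℒa)){-|ℒ|-1}` "the map `ξ_a^{V_D}(ℒ)` is a
grading-preserving map of graded `R`-modules"; §7.1: `𝒞̄(D)` is "a complex of graded abelian
groups with a grading-preserving differential". D. Bar-Natan, *On Khovanov's categorification
of the Jones polynomial*, Algebr. Geom. Topol. 2 (2002) 337–370, §3.2: the edge maps `d_ξ` are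
"of degree `0`" because "the maps `m` and `Δ` must be of degree `-1`".

Proof (enhanced-state model of `KhComplex`, for *abstract* Gauss diagrams — no realisability is
needed). The combinatorial core is a surgery lemma on state circles: if two states agree off a
chord `i`, their state graphs differ only by edges among the four arcs at chord `i`, each of
which lies on the state circle of `A = arcIn (overPos i)` or of `B = arcOut (overPos i)`
(`adj_or_near_of_agree`, `reachable_or_near_of_agree`, by induction along walks). Hence, when
`A`, `B` lie on two circles of one state and on one circle of the other (merge, resp. split,
using the proved fact `IsMergeAt.not_isSplitAt_holds`), the remaining circles of the two states
correspond bijectively with the same arcs and labels (`card_filter_circle_surgery`), so that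
`#(circles labelled 𝟙) - #(circles labelled X)` changes by `deg ℓ(A) + deg ℓ(B) - deg ℓ'(A∪B)`
(`qDegree_sub_weight_surgery`, `deg 𝟙 = 1`, `deg X = -1`). At `h = t = 0` a nonzero structure
constant of `m` (resp. `Δ`) forces `deg c = deg a + deg b - 1` (resp. `deg b + deg c = deg a - 1`),
which together with `|s'| = |s| + 1` (`State.weight_update`) gives `qDegree s' = qDegree s`.

## References

* M. Khovanov, *A categorification of the Jones polynomial*, Duke Math. J. 101 (2000)
  359–426, §2.2 (`deg 𝟙 = 1`, `deg X = -1`, `m` of degree `-1`), §4.2 (grading-preserving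
  structure maps, Prop. 8), §7.1. [cite: Khovanov2000, §4.2]
* D. Bar-Natan, *On Khovanov's categorification of the Jones polynomial*, Algebr. Geom.
  Topol. 2 (2002) 337–370, §3.2 (`d_ξ` of degree `0`; `m`, `Δ` of degree `-1`).
  [cite: BarNatan2002, §3.2]
* O. Viro, *Khovanov homology, its definitions and ramifications*, Fund. Math. 184 (2004)
  317–342, §5.2 (incident enhanced states differ by one Morse modification). [cite: Viro2004, §5.2]
-/

open Function Set

noncomputable section

namespace Literature.Topology.FourManifolds

namespace GaussDiagram

variable {G : GaussDiagram}

/-! ## Locality of a change of smoothing -/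

/-- Each of the two arcs at a marked point `p` of chord `i` (`arcIn p`, `arcOut p`) lies, in every
state, on the state circle of `arcIn (overPos i)` or on that of `arcOut (overPos i)`: for
`p = overPos i` trivially, for `p = underPos i` because its ends are glued to ends at `overPos i`.
[folklore] -/
theorem reachable_arcs_of_chordOf_eq (σ : G.State) {i : Fin G.n} {p : Fin (2 * G.n)}
    (hp : G.chordOf p = i) :
    ((G.stateGraph σ).Reachable (G.arcIn (G.overPos i)) (G.arcIn p) ∨
        (G.stateGraph σ).Reachable (G.arcOut (G.overPos i)) (G.arcIn p)) ∧
      ((G.stateGraph σ).Reachable (G.arcIn (G.overPos i)) (G.arcOut p) ∨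
        (G.stateGraph σ).Reachable (G.arcOut (G.overPos i)) (G.arcOut p)) := by
  have hp' : p = G.overPos i ∨ p = G.underPos i := by
    rcases G.chordOf_spec p with h | h
    · exact Or.inl (by rw [← h, hp])
    · exact Or.inr (by rw [← h, hp])
  rcases hp' with rfl | rfl
  · exact ⟨Or.inl (SimpleGraph.Reachable.refl _), Or.inr (SimpleGraph.Reachable.refl _)⟩
  · have hN : ∀ e : Fin (2 * G.n) × Bool, e.1 = G.overPos i →
        (G.stateGraph σ).Reachable (G.arcIn (G.overPos i)) (G.endArc e) ∨
          (G.stateGraph σ).Reachable (G.arcOut (G.overPos i)) (G.endArc e) := by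
      rintro ⟨p, c⟩ hp
      dsimp only at hp
      subst hp
      cases c
      · exact Or.inl (SimpleGraph.Reachable.refl _)
      · exact Or.inr (SimpleGraph.Reachable.refl _)
    have key : ∀ b : Bool,
        (G.stateGraph σ).Reachable (G.arcIn (G.overPos i)) (G.endArc (G.underPos i, b)) ∨
          (G.stateGraph σ).Reachable (G.arcOut (G.overPos i)) (G.endArc (G.underPos i, b)) := by
      intro b
      have hr := G.reachable_endArc_endGlue σ (G.underPos i, b)
      have h1 : (G.endGlue σ (G.underPos i, b)).1 = G.overPos i := by simp [endGlue]
      exact (hN _ h1).imp (fun h ↦ h.trans hr.symm) (fun h ↦ h.trans hr.symm)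
    exact ⟨key false, key true⟩

/-- **Locality of a change of smoothing.** If two states `σ`, `τ` agree at every chord other
than `i`, an edge of the state graph of `τ` is an edge of the state graph of `σ`, unless both
its ends are among the four arcs at chord `i` — which lie on the state circles (for `σ`) of
`arcIn (overPos i)` or `arcOut (overPos i)`. Viro (2004), §5.2 (incident states differ by a
single Morse modification at the site of the chord). [folklore] -/
theorem adj_or_near_of_agree {σ τ : G.State} {i : Fin G.n} (hστ : ∀ j, j ≠ i → τ j = σ j)
    {x y : G.Arc} (h : (G.stateGraph τ).Adj x y) :
    (G.stateGraph σ).Adj x y ∨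
      (((G.stateGraph σ).Reachable (G.arcIn (G.overPos i)) x ∨
          (G.stateGraph σ).Reachable (G.arcOut (G.overPos i)) x) ∧
        ((G.stateGraph σ).Reachable (G.arcIn (G.overPos i)) y ∨
          (G.stateGraph σ).Reachable (G.arcOut (G.overPos i)) y)) := by
  -- one direction of the reconnection relation
  have key : ∀ x y, G.stateAdj τ x y → G.stateAdj σ x y ∨
      (((G.stateGraph σ).Reachable (G.arcIn (G.overPos i)) x ∨
          (G.stateGraph σ).Reachable (G.arcOut (G.overPos i)) x) ∧
        ((G.stateGraph σ).Reachable (G.arcIn (G.overPos i)) y ∨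
          (G.stateGraph σ).Reachable (G.arcOut (G.overPos i)) y)) := by
    rintro x y ⟨hne, p, hp⟩
    by_cases hc : G.chordOf p = i
    · right
      have h1 := reachable_arcs_of_chordOf_eq σ hc
      have h2 := reachable_arcs_of_chordOf_eq σ (p := G.partner p) (by rw [chordOf_partner, hc])
      rcases hp with ⟨-, ⟨rfl, rfl⟩ | ⟨rfl, rfl⟩⟩ | ⟨-, ⟨rfl, rfl⟩ | ⟨rfl, rfl⟩⟩
      · exact ⟨h1.1, h2.2⟩
      · exact ⟨h2.2, h1.1⟩
      · exact ⟨h1.1, h2.1⟩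
      · exact ⟨h1.2, h2.2⟩
    · left
      have hs : G.isSeifert τ (G.chordOf p) = G.isSeifert σ (G.chordOf p) := by
        simp [isSeifert, hστ _ hc]
      rw [hs] at hp
      exact ⟨hne, p, hp⟩
  rw [stateGraph, SimpleGraph.fromRel_adj] at h
  obtain ⟨hne, h | h⟩ := h
  · rcases key x y h with h' | h'
    · left; rw [stateGraph, SimpleGraph.fromRel_adj]; exact ⟨hne, Or.inl h'⟩
    · exact Or.inr h'
  · rcases key y x h with h' | h'
    · left; rw [stateGraph, SimpleGraph.fromRel_adj]; exact ⟨hne, Or.inr h'⟩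
    · exact Or.inr h'.symm

/-- If two states `σ`, `τ` agree off chord `i`, two arcs on the same state circle of `τ` are on
the same state circle of `σ`, unless both lie on the state circles (for `σ`) of
`arcIn (overPos i)` or `arcOut (overPos i)` (induction along a walk, `adj_or_near_of_agree`).
[folklore] -/
theorem reachable_or_near_of_agree {σ τ : G.State} {i : Fin G.n} (hστ : ∀ j, j ≠ i → τ j = σ j)
    {x y : G.Arc} (h : (G.stateGraph τ).Reachable x y) :
    (G.stateGraph σ).Reachable x y ∨
      (((G.stateGraph σ).Reachable (G.arcIn (G.overPos i)) x ∨
          (G.stateGraph σ).Reachable (G.arcOut (G.overPos i)) x) ∧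
        ((G.stateGraph σ).Reachable (G.arcIn (G.overPos i)) y ∨
          (G.stateGraph σ).Reachable (G.arcOut (G.overPos i)) y)) := by
  obtain ⟨w⟩ := h
  induction w with
  | nil => exact Or.inl (SimpleGraph.Reachable.refl _)
  | cons hadj w ih =>
    rcases adj_or_near_of_agree hστ hadj with h1 | ⟨hx, hz⟩
    · rcases ih with h2 | ⟨hz, hy⟩
      · exact Or.inl (h1.reachable.trans h2)
      · exact Or.inr ⟨hz.imp (fun h ↦ h.trans h1.reachable.symm)
          (fun h ↦ h.trans h1.reachable.symm), hy⟩
    · rcases ih with h2 | ⟨_, hy⟩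
      · exact Or.inr ⟨hx, hz.imp (fun h ↦ h.trans h2) (fun h ↦ h.trans h2)⟩
      · exact Or.inr ⟨hx, hy⟩

/-! ## Labels along state circles -/

/-- Two arcs lie on the same state circle iff a walk of the state graph joins them. [folklore] -/
theorem circleOf_eq_iff {σ : G.State} {x y : G.Arc} :
    G.circleOf σ x = G.circleOf σ y ↔ (G.stateGraph σ).Reachable x y :=
  SimpleGraph.ConnectedComponent.eq

/-- The labels of an enhanced state agree on arcs joined by a walk in the state graph. [folklore] -/
theorem EnhancedState.label_eq_of_reachable (s : G.EnhancedState) {x y : G.Arc}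
    (h : (G.stateGraph s.state).Reachable x y) : s.label x = s.label y := by
  obtain ⟨w⟩ := h
  induction w with
  | nil => rfl
  | cons hadj _ ih => exact (s.label_eq _ _ hadj).trans ih

/-- The labels of an enhanced state are constant along state circles. Viro (2004), §5.1. [folklore] -/
theorem EnhancedState.label_eq_of_circleOf_eq (s : G.EnhancedState) {x y : G.Arc}
    (h : G.circleOf s.state x = G.circleOf s.state y) : s.label x = s.label y :=
  s.label_eq_of_reachable (circleOf_eq_iff.mp h)

/-- The circle of the arc `x` is counted among the circles labelled `b` iff `x` has label `b`.
[folklore] -/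
theorem EnhancedState.circleOf_mem_filter_iff (s : G.EnhancedState) (b : Bool) (x : G.Arc) :
    G.circleOf s.state x ∈ (Finset.univ.filter fun c : G.StateCircle s.state ↦
      ∃ a, G.circleOf s.state a = c ∧ s.label a = b) ↔ s.label x = b := by
  simp only [Finset.mem_filter, Finset.mem_univ, true_and]
  constructor
  · rintro ⟨a, ha, hb⟩
    rw [← hb]
    exact s.label_eq_of_circleOf_eq ha.symm
  · exact fun hb ↦ ⟨x, rfl, hb⟩

/-! ## The surgery lemma -/

/-- `#(S ∩ {a, b}) = [a ∈ S] + [b ∈ S]` for `a ≠ b`. [folklore] -/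
private theorem card_inter_pair {α : Type*} [DecidableEq α] (S : Finset α) {a b : α}
    (hab : a ≠ b) :
    (S ∩ {a, b}).card = (if a ∈ S then 1 else 0) + (if b ∈ S then 1 else 0) := by
  rw [Finset.inter_comm, ← Finset.filter_mem_eq_inter, Finset.card_filter, Finset.sum_pair hab]

/-- `#(S ∩ {a}) = [a ∈ S]`. [folklore] -/
private theorem card_inter_singleton' {α : Type*} [DecidableEq α] (S : Finset α) (a : α) :
    (S ∩ {a}).card = if a ∈ S then 1 else 0 := by
  rw [Finset.inter_comm, ← Finset.filter_mem_eq_inter, Finset.card_filter, Finset.sum_singleton]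

/-- **Surgery lemma (counting).** Let the enhanced states `s₁`, `s₂` have states agreeing off
chord `i`, and let `A = arcIn (overPos i)`, `B = arcOut (overPos i)` lie on two different state
circles of `s₁` but on one state circle of `s₂`, the labels of `s₁`, `s₂` being equal off that
circle of `s₂`. Then for each label `b` the circles of `s₁` labelled `b` other than those of
`A`, `B` correspond bijectively to the circles of `s₂` labelled `b` other than that of `A`:
`#S₁(b) + [ℓ₂ A = b] = #S₂(b) + [ℓ₁ A = b] + [ℓ₁ B = b]` ("a merge joins two circles, a split
cuts one, all other circles are unchanged": Viro (2004), §5.2; Bar-Natan (2002), §3.2; valid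
for abstract Gauss diagrams). [folklore] -/
theorem card_filter_circle_surgery {s₁ s₂ : G.EnhancedState} {i : Fin G.n}
    (h₁₂ : ∀ j, j ≠ i → s₂.state j = s₁.state j)
    (hne : G.circleOf s₁.state (G.arcIn (G.overPos i)) ≠
      G.circleOf s₁.state (G.arcOut (G.overPos i)))
    (heq : G.circleOf s₂.state (G.arcIn (G.overPos i)) =
      G.circleOf s₂.state (G.arcOut (G.overPos i)))
    (hlab : ∀ x, G.circleOf s₂.state x ≠ G.circleOf s₂.state (G.arcIn (G.overPos i)) →
      s₂.label x = s₁.label x)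
    (b : Bool) :
    (Finset.univ.filter fun c : G.StateCircle s₁.state ↦
        ∃ a, G.circleOf s₁.state a = c ∧ s₁.label a = b).card +
      (if s₂.label (G.arcIn (G.overPos i)) = b then 1 else 0) =
    (Finset.univ.filter fun c : G.StateCircle s₂.state ↦
        ∃ a, G.circleOf s₂.state a = c ∧ s₂.label a = b).card +
      (if s₁.label (G.arcIn (G.overPos i)) = b then 1 else 0) +
      (if s₁.label (G.arcOut (G.overPos i)) = b then 1 else 0) := by
  set A := G.arcIn (G.overPos i)
  set B := G.arcOut (G.overPos i)
  set S₁ := (Finset.univ.filter fun c : G.StateCircle s₁.state ↦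
        ∃ a, G.circleOf s₁.state a = c ∧ s₁.label a = b) with hS₁
  set S₂ := (Finset.univ.filter fun c : G.StateCircle s₂.state ↦
        ∃ a, G.circleOf s₂.state a = c ∧ s₂.label a = b) with hS₂
  have h₂₁ : ∀ j, j ≠ i → s₁.state j = s₂.state j := fun j hj ↦ (h₁₂ j hj).symm
  -- arcs near chord `i` lie on the circle of `A` in `s₂`, on the circles of `A` or `B` in `s₁`
  have hN₂ : ∀ z, ((G.stateGraph s₂.state).Reachable A z ∨ (G.stateGraph s₂.state).Reachable B z) →
      G.circleOf s₂.state z = G.circleOf s₂.state A := by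
    rintro z (h | h)
    · exact (circleOf_eq_iff.mpr h).symm
    · rw [heq]; exact (circleOf_eq_iff.mpr h).symm
  have hN₁ : ∀ z, ((G.stateGraph s₁.state).Reachable A z ∨ (G.stateGraph s₁.state).Reachable B z) →
      G.circleOf s₁.state z = G.circleOf s₁.state A ∨
        G.circleOf s₁.state z = G.circleOf s₁.state B := by
    rintro z (h | h)
    · exact Or.inl (circleOf_eq_iff.mpr h).symm
    · exact Or.inr (circleOf_eq_iff.mpr h).symm
  -- transfer of circles between the two states
  have h12 : ∀ x y, G.circleOf s₁.state x = G.circleOf s₁.state y →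
      G.circleOf s₂.state x = G.circleOf s₂.state y := by
    intro x y h
    rcases reachable_or_near_of_agree (σ := s₂.state) (τ := s₁.state) h₂₁
      (circleOf_eq_iff.mp h) with h | ⟨hx, hy⟩
    · exact circleOf_eq_iff.mpr h
    · rw [hN₂ x hx, hN₂ y hy]
  have h21 : ∀ x y, G.circleOf s₂.state x = G.circleOf s₂.state y →
      G.circleOf s₁.state x = G.circleOf s₁.state y ∨
        ((G.circleOf s₁.state x = G.circleOf s₁.state A ∨
            G.circleOf s₁.state x = G.circleOf s₁.state B) ∧
          (G.circleOf s₁.state y = G.circleOf s₁.state A ∨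
            G.circleOf s₁.state y = G.circleOf s₁.state B)) := by
    intro x y h
    rcases reachable_or_near_of_agree (σ := s₁.state) (τ := s₂.state) h₁₂
      (circleOf_eq_iff.mp h) with h | ⟨hx, hy⟩
    · exact Or.inl (circleOf_eq_iff.mpr h)
    · exact Or.inr ⟨hN₁ x hx, hN₁ y hy⟩
  -- the induced map on circles
  let φ : G.StateCircle s₁.state → G.StateCircle s₂.state :=
    SimpleGraph.ConnectedComponent.lift (fun a ↦ G.circleOf s₂.state a)
      (fun v w p _ ↦ h12 v w (circleOf_eq_iff.mpr p.reachable))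
  have hφ : ∀ x, φ (G.circleOf s₁.state x) = G.circleOf s₂.state x := fun x ↦ rfl
  -- off the circles of `A`, `B` it is a bijection respecting labels
  have hbij : (S₁ \ {G.circleOf s₁.state A, G.circleOf s₁.state B}).card =
      (S₂ \ {G.circleOf s₂.state A}).card := by
    refine Finset.card_bij (fun c _ ↦ φ c) ?_ ?_ ?_
    · intro c hc
      induction c using SimpleGraph.ConnectedComponent.ind with | h x => ?_
      change G.circleOf s₁.state x ∈ _ at hc
      simp only [Finset.mem_sdiff, Finset.mem_insert, Finset.mem_singleton, not_or] at hc ⊢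
      obtain ⟨hxS, hxA, hxB⟩ := hc
      rw [hS₁, s₁.circleOf_mem_filter_iff] at hxS
      have hx₂ : G.circleOf s₂.state x ≠ G.circleOf s₂.state A := by
        intro h
        rcases h21 x A h with h | ⟨h, -⟩
        · exact hxA h
        · exact h.elim hxA hxB
      change G.circleOf s₂.state x ∈ S₂ ∧ _
      rw [hS₂, s₂.circleOf_mem_filter_iff, hlab x hx₂]
      exact ⟨hxS, hx₂⟩
    · intro c hc c' hc' h
      induction c using SimpleGraph.ConnectedComponent.ind with | h x => ?_
      induction c' using SimpleGraph.ConnectedComponent.ind with | h x' => ?_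
      change G.circleOf s₂.state x = G.circleOf s₂.state x' at h
      change G.circleOf s₁.state x ∈ _ at hc
      change G.circleOf s₁.state x' ∈ _ at hc'
      simp only [Finset.mem_sdiff, Finset.mem_insert, Finset.mem_singleton, not_or] at hc hc'
      rcases h21 x x' h with h' | ⟨h', -⟩
      · exact h'
      · exact (h'.elim hc.2.1 hc.2.2).elim
    · intro c' hc'
      induction c' using SimpleGraph.ConnectedComponent.ind with | h x => ?_
      change G.circleOf s₂.state x ∈ _ at hc'
      simp only [Finset.mem_sdiff, Finset.mem_singleton] at hc'
      obtain ⟨hxS, hxA⟩ := hc'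
      rw [hS₂, s₂.circleOf_mem_filter_iff, hlab x hxA] at hxS
      refine ⟨G.circleOf s₁.state x, ?_, hφ x⟩
      simp only [Finset.mem_sdiff, Finset.mem_insert, Finset.mem_singleton, not_or]
      refine ⟨by rw [hS₁, s₁.circleOf_mem_filter_iff]; exact hxS, fun h ↦ hxA (h12 x A h),
        fun h ↦ hxA ?_⟩
      rw [h12 x B h, heq]
  -- count
  have hd₁ := Finset.card_sdiff_add_card_inter S₁ {G.circleOf s₁.state A, G.circleOf s₁.state B}
  have hd₂ := Finset.card_sdiff_add_card_inter S₂ {G.circleOf s₂.state A}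
  have hAS₁ : G.circleOf s₁.state A ∈ S₁ ↔ s₁.label A = b := s₁.circleOf_mem_filter_iff b A
  have hBS₁ : G.circleOf s₁.state B ∈ S₁ ↔ s₁.label B = b := s₁.circleOf_mem_filter_iff b B
  have hAS₂ : G.circleOf s₂.state A ∈ S₂ ↔ s₂.label A = b := s₂.circleOf_mem_filter_iff b A
  rw [card_inter_pair S₁ hne] at hd₁
  rw [card_inter_singleton' S₂] at hd₂
  simp only [hAS₁, hBS₁] at hd₁
  simp only [hAS₂] at hd₂
  omega

/-- At `h = t = 0` a nonzero structure constant of the multiplication pins the labels: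
`m(𝟙 ⊗ 𝟙) = 𝟙`, `m(𝟙 ⊗ X) = m(X ⊗ 𝟙) = X` (Khovanov (2000), §2.2), i.e. with `deg 𝟙 = 1`,
`deg X = -1`: `deg c = deg a + deg b - 1`. [folklore] -/
private theorem deg_of_mergeCoeff_ne_zero {a b c : Bool} (h : mergeCoeff ℤ 0 0 a b c ≠ 0) :
    (if c then -1 else 1 : ℤ) = (if a then -1 else 1) + (if b then -1 else 1) - 1 := by
  cases a <;> cases b <;> cases c <;> first | decide | exact (h rfl).elim

/-- At `h = t = 0` a nonzero structure constant of the comultiplication pins the labels: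
`Δ 𝟙 = 𝟙 ⊗ X + X ⊗ 𝟙`, `Δ X = X ⊗ X` (Khovanov (2000), §2.2), i.e. `deg b + deg c = deg a - 1`.
[folklore] -/
private theorem deg_of_splitCoeff_ne_zero {a b c : Bool} (h : splitCoeff ℤ 0 0 a b c ≠ 0) :
    (if b then -1 else 1 : ℤ) + (if c then -1 else 1) = (if a then -1 else 1) - 1 := by
  cases a <;> cases b <;> cases c <;> first | decide | exact (h rfl).elim

/-- **Surgery lemma (degrees).** Under the hypotheses of `card_filter_circle_surgery`, the label
part `#(circles labelled 𝟙) - #(circles labelled X)` of the quantum degree satisfies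
`D(s₁) = D(s₂) - deg ℓ₂(A) + deg ℓ₁(A) + deg ℓ₁(B)` (`deg 𝟙 = 1`, `deg X = -1`). [folklore] -/
theorem qDegree_sub_weight_surgery {s₁ s₂ : G.EnhancedState} {i : Fin G.n}
    (h₁₂ : ∀ j, j ≠ i → s₂.state j = s₁.state j)
    (hne : G.circleOf s₁.state (G.arcIn (G.overPos i)) ≠
      G.circleOf s₁.state (G.arcOut (G.overPos i)))
    (heq : G.circleOf s₂.state (G.arcIn (G.overPos i)) =
      G.circleOf s₂.state (G.arcOut (G.overPos i)))
    (hlab : ∀ x, G.circleOf s₂.state x ≠ G.circleOf s₂.state (G.arcIn (G.overPos i)) →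
      s₂.label x = s₁.label x) :
    qDegree s₁ - s₁.state.weight =
      qDegree s₂ - s₂.state.weight - (if s₂.label (G.arcIn (G.overPos i)) then -1 else 1) +
        (if s₁.label (G.arcIn (G.overPos i)) then -1 else 1) +
        (if s₁.label (G.arcOut (G.overPos i)) then -1 else 1) := by
  have hF := card_filter_circle_surgery h₁₂ hne heq hlab false
  have hT := card_filter_circle_surgery h₁₂ hne heq hlab true
  unfold qDegree
  cases h1 : s₁.label (G.arcIn (G.overPos i)) <;> cases h2 : s₁.label (G.arcOut (G.overPos i)) <;>
    cases h3 : s₂.label (G.arcIn (G.overPos i)) <;>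
    simp only [h1, h2, h3, if_true, if_false, Bool.false_eq_true, Bool.true_eq_false] at hF hT ⊢ <;>
    omega

/-! ## Discharge -/

/-- **The Khovanov differential preserves the quantum degree** (`qDegree_eq_of_incidence_ne_zero`
holds): at `h = t = 0`, a nonzero integral incidence number `⟨d s, s'⟩` forces
`qDegree s' = qDegree s`. Khovanov (2000), §4.2 (the structure map `ξ_a^{V_D}(ℒ)` of the cube is
grading-preserving: `F(S)` has degree `-1 = χ(S)` for the saddle `S`, compensated by the shifts
`{-|ℒ|}`, `{-|ℒ|-1}`), §7.1 (grading-preserving differential of `𝒞̄(D)`); Bar-Natan (2002),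
§3.2 (`d_ξ` of degree `0`; `m`, `Δ` of degree `-1`). Proof: unfold `incidence`; in the merge
(resp. split) case apply `qDegree_sub_weight_surgery` to `(s, s')` (resp. `(s', s)`, with
`IsMergeAt.not_isSplitAt_holds`), `State.weight_update`, and the label constraints
`deg_of_mergeCoeff_ne_zero` / `deg_of_splitCoeff_ne_zero`. [cite: Khovanov2000, §4.2] -/
theorem qDegree_eq_of_incidence_ne_zero_holds : qDegree_eq_of_incidence_ne_zero (G := G) := by
  intro s s' h0
  unfold incidence at h0
  by_cases hi : ∃ i, s.state i = false ∧ s'.state = Function.update s.state i true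
  swap
  · exact (h0 (by rw [dif_neg hi])).elim
  rw [dif_pos hi] at h0
  obtain ⟨hi0, hs'⟩ := Classical.choose_spec hi
  dsimp only at h0
  generalize Classical.choose hi = i at h0 hi0 hs'
  have hag : ∀ j, j ≠ i → s'.state j = s.state j := fun j hj ↦ by
    rw [hs', Function.update_of_ne hj]
  have hag' : ∀ j, j ≠ i → s.state j = s'.state j := fun j hj ↦ (hag j hj).symm
  have hw : s'.state.weight = s.state.weight + 1 := by rw [hs', State.weight_update hi0]
  by_cases hM : G.IsMergeAt s.state i
  · rw [if_pos hM] at h0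
    by_cases hl : ∀ c, G.circleOf s'.state c ≠ G.circleOf s'.state (G.arcIn (G.overPos i)) →
        s'.label c = s.label c
    swap
    · exact (h0 (by rw [if_neg hl])).elim
    rw [if_pos hl] at h0
    have hc := deg_of_mergeCoeff_ne_zero (right_ne_zero_of_mul h0)
    have heq : G.circleOf s'.state (G.arcIn (G.overPos i)) =
        G.circleOf s'.state (G.arcOut (G.overPos i)) := by
      by_contra h
      refine IsMergeAt.not_isSplitAt_holds hM ⟨hi0, ?_⟩
      rwa [hs'] at h
    have key := qDegree_sub_weight_surgery hag hM.2 heq hl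
    rw [hw] at key
    push_cast at key hc ⊢
    omega
  · rw [if_neg hM] at h0
    by_cases hS : G.IsSplitAt s.state i
    swap
    · exact (h0 (by rw [if_neg hS])).elim
    rw [if_pos hS] at h0
    by_cases hl : ∀ c, G.circleOf s.state c ≠ G.circleOf s.state (G.arcIn (G.overPos i)) →
        s'.label c = s.label c
    swap
    · exact (h0 (by rw [if_neg hl])).elim
    rw [if_pos hl] at h0
    have hc := deg_of_splitCoeff_ne_zero (right_ne_zero_of_mul h0)
    have hne : G.circleOf s'.state (G.arcIn (G.overPos i)) ≠
        G.circleOf s'.state (G.arcOut (G.overPos i)) := by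
      have h := hS.2
      rwa [← hs'] at h
    have heq : G.circleOf s.state (G.arcIn (G.overPos i)) =
        G.circleOf s.state (G.arcOut (G.overPos i)) := by
      by_contra h
      exact hM ⟨hi0, h⟩
    have key := qDegree_sub_weight_surgery hag' hne heq (fun x hx ↦ (hl x hx).symm)
    rw [hw] at key
    push_cast at key hc ⊢
    omega

end GaussDiagram

end Literature.Topology.FourManifolds
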